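import Summits.BirchSwinnertonDyer.BirchSwinnertonDyer.Theorems.GenusKolyvaginAtTwoLeafCensusWallTorsionCell
import HarnessLib

/-!
# Route `GenusKolyvaginAtTwo` — census certificate for the pen's (750)(2) item (i): `ExactDescentAtTwo` (stmt-BirchSwinnertonDyer-22138) BY NAME ⟸ the
# four WALL binders of `closes` (LEAD bsd-line-gk2-p1 g32)

Seat `bsd-line-gk2-p1` g32 (LEAD lineage).  THEOREMS ONLY, standard axioms, no `sorry`.  **BSD is NOT proved; 22138 and the WALL rows stay OPEN; nothing is
closed** (the theorem is CONDITIONAL on the four WALL items, which are open).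

`ExactDescentAtTwo` (the route's original rank-`0` habitat target, crux r4, not a binder of `closes` since rev 65) concludes `BSD₂(W)` for a NON-CM curve of
ANALYTIC RANK `0` (under many further hypotheses: big image, odd Tamagawa, a Heegner frame, an exact depth, a minimal twin with `#Sel₂ = 2` and its
`BSD₂`).  The four GK2 WALL binders `Wall{GoodOrdinary,Multiplicative,Supersingular,Additive}RankZeroAtTwo` give `BSD₂` for EVERY non-CM curve of
analytic rank `0` (p798939 `…Census.TorsionCell.bsdp_rankZero_of_wallGK2`), so they imply 22138 BY NAME, ignoring all its other hypotheses — the kernel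
form of the pen's census verdict «(i) superseded: implied by the Wall binders» (bsd-idea-1 g30, 2026-08-31 04:47Z, for director (750)(2)/BLOCK #144).
[cite: Miller2011LMS, Def. 1.1]
-/

set_option autoImplicit false
set_option linter.dupNamespace false -- `Summit.<P>.<Sub>` repeats `BirchSwinnertonDyer` (D-0017)

noncomputable section

open scoped Classical

namespace Summit.BirchSwinnertonDyer.BirchSwinnertonDyer.Theorems.GenusExact.Census.ExactDescentOfWall

open Summit.BirchSwinnertonDyer.BirchSwinnertonDyer.Theses.GenusKolyvaginAtTwo
  (WallGoodOrdinaryRankZeroAtTwo WallMultiplicativeRankZeroAtTwo WallSupersingularRankZeroAtTwo WallAdditiveRankZeroAtTwo ExactDescentAtTwo)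
open Summit.BirchSwinnertonDyer.BirchSwinnertonDyer.Theorems.GenusExact.Census.TorsionCell (bsdp_rankZero_of_wallGK2)

/-- ★ **`ExactDescentAtTwo` (22138) BY NAME ⟸ WALL(GK2)×4**: the item's conclusion `BSD₂(W)` is asked only for non-CM `W` of analytic rank `0`, which the
four WALL binders cover (tetrachotomy of the reduction type at `2`); every other hypothesis of 22138 is discarded.  CONDITIONAL on the four open WALL items;
proves nothing about BSD; closes nothing. [cite: Miller2011LMS, Def. 1.1] -/
theorem exactDescentAtTwo_of_wallGK2 (hOrd : WallGoodOrdinaryRankZeroAtTwo) (hMult : WallMultiplicativeRankZeroAtTwo)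
    (hSS : WallSupersingularRankZeroAtTwo) (hAdd : WallAdditiveRankZeroAtTwo) : ExactDescentAtTwo := by
  intro W _ _ _ hcm hr0
  intros
  exact bsdp_rankZero_of_wallGK2 hOrd hMult hSS hAdd W hcm hr0

end Summit.BirchSwinnertonDyer.BirchSwinnertonDyer.Theorems.GenusExact.Census.ExactDescentOfWall

end
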